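import Mathlib
import Literature.Analysis.FluidPDE.VectorCalculus
import Literature.Analysis.FluidPDE.TaoAveragedNondegeneracy
import Literature.Analysis.FluidPDE.LeiZhang2011Proofs
import Summits.NavierStokesRegularity.NavierStokesRegularity.Theorems.FilamentSkeletonRssSkeletonEquilibriumGyrationFreeArcs
import Summits.NavierStokesRegularity.NavierStokesRegularity.Theorems.FilamentSkeletonRssSkeletonEquilibriumGyrationContinuity
import Summits.NavierStokesRegularity.NavierStokesRegularity.Theorems.FilamentSkeletonRssSkeletonEquilibriumMirrorPointLimitTools

/-!
# `stub_mirrorPointSelection`, compactness step: limits of shell-gyration-free solutions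
(helper for the registered stub `stub_mirrorPointSelection` of crux `FilamentSkeletonRss.SkeletonEquilibrium`,
stmt-NavierStokesRegularity-15400; notation of `…GyrationFreeRigidity`)

* `drift_ne_zero` — `A y ≠ 0` for `y ≠ 0`;
* `exists_Ioo_ne_zero` — a unit-speed `C²` curve is nonzero on some `(0, δ)`;
* `locus_of_limit` — if `C²` unit-speed solutions `Z m` of `Y″ = g • Y′ × A Y` with `‖Z m 0‖ ≤ 2` have data at `0`
  converging to the data of a solution `Ys`, and their defects satisfy the stub's shell bound with parameters
  `ε m → 0`, `R₁ m → 0`, `R₃ m → ∞`, then `Ys` satisfies the polynomial locus equation `F = 0` at every `t ≥ 0`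
  with `Ys t ≠ 0` (forward Grönwall `continuous_dependence_forward`, `smul_defect_eq_locus`, `continuous_locus`).
No summit statement is proved; NS regularity is not touched.
-/

noncomputable section

open Set Filter Topology
open Literature.Analysis.FluidPDE Literature.Analysis.FluidPDE.Tao2016
open scoped RealInnerProductSpace InnerProductSpace

namespace Summit.NavierStokesRegularity.NavierStokesRegularity.Theorems.SkeletonEquilibrium.MirrorPoint
set_option linter.dupNamespace false

/-- `⟪A y, y⟫ = ½ ‖y‖²`, hence `A y ≠ 0` for `y ≠ 0`. [folklore] -/
theorem drift_ne_zero (α : ℝ) {y : EuclideanSpace ℝ (Fin 3)} (hy : y ≠ 0) :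
    (1 / 2 : ℝ) • y - α • cross (EuclideanSpace.single (2 : Fin 3) (1 : ℝ)) y ≠ 0 := by
  intro h
  have h1 : ⟪(1 / 2 : ℝ) • y - α • cross (EuclideanSpace.single (2 : Fin 3) (1 : ℝ)) y, y⟫ = 1 / 2 * ‖y‖ ^ 2 := by
    rw [inner_sub_left, real_inner_smul_left, real_inner_smul_left, inner_cross_self_right, mul_zero,
      sub_zero, real_inner_self_eq_norm_sq]
  rw [h, inner_zero_left] at h1
  have : ‖y‖ = 0 := by nlinarith [norm_nonneg y]
  exact hy (norm_eq_zero.1 this)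

/-- A unit-speed `C²` curve is nonzero on some interval `(0, δ)` (`HasDerivAt.eventually_ne`). [folklore] -/
theorem exists_Ioo_ne_zero {Ys : ℝ → EuclideanSpace ℝ (Fin 3)} (hYs : ContDiff ℝ 2 Ys)
    (hunit : ∀ s, ‖deriv Ys s‖ = 1) : ∃ δ : ℝ, 0 < δ ∧ ∀ t ∈ Ioo 0 δ, Ys t ≠ 0 := by
  have hd : HasDerivAt Ys (deriv Ys 0) 0 := ((hYs.differentiable (by norm_num)) 0).hasDerivAt
  have hne : deriv Ys 0 ≠ 0 := fun h => by
    have := hunit 0; rw [h, norm_zero] at this; exact zero_ne_one this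
  have hev : ∀ᶠ z in 𝓝[≠] (0 : ℝ), Ys z ≠ 0 := hd.eventually_ne hne
  have hev' : ∀ᶠ z in 𝓝[>] (0 : ℝ), Ys z ≠ 0 :=
    hev.filter_mono (nhdsWithin_mono _ (fun x (hx : 0 < x) => ne_of_gt hx))
  obtain ⟨u, hu, hsub⟩ := mem_nhdsGT_iff_exists_Ioo_subset.1 hev'
  exact ⟨u, hu, fun t ht => hsub ht⟩

/-- **The limit of shell-gyration-free solutions lies on the locus.** [folklore] -/
theorem locus_of_limit {g α : ℝ} (hg : g ≠ 0)
    {Z : ℕ → ℝ → EuclideanSpace ℝ (Fin 3)} {Ys : ℝ → EuclideanSpace ℝ (Fin 3)} {ε R₁ R₃ : ℕ → ℝ}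
    (hZ : ∀ m, ContDiff ℝ 2 (Z m)) (hZu : ∀ m s, ‖deriv (Z m) s‖ = 1)
    (hZo : ∀ m s, iteratedDeriv 2 (Z m) s = g • cross (deriv (Z m) s)
      ((1 / 2 : ℝ) • Z m s - α • cross (EuclideanSpace.single (2 : Fin 3) (1 : ℝ)) (Z m s)))
    (hZ0 : ∀ m, ‖Z m 0‖ ≤ 2)
    (hsh : ∀ m s, R₁ m ≤ ‖Z m s‖ → ‖Z m s‖ ≤ R₃ m →
      ‖deriv (Z m) s -
          ⟪deriv (Z m) s, ‖(1 / 2 : ℝ) • Z m s - α • cross (EuclideanSpace.single (2 : Fin 3) (1 : ℝ)) (Z m s)‖⁻¹ •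
            ((1 / 2 : ℝ) • Z m s - α • cross (EuclideanSpace.single (2 : Fin 3) (1 : ℝ)) (Z m s))⟫ •
          (‖(1 / 2 : ℝ) • Z m s - α • cross (EuclideanSpace.single (2 : Fin 3) (1 : ℝ)) (Z m s)‖⁻¹ •
            ((1 / 2 : ℝ) • Z m s - α • cross (EuclideanSpace.single (2 : Fin 3) (1 : ℝ)) (Z m s))) -
        (⟪deriv (Z m) s, ‖(1 / 2 : ℝ) • Z m s - α • cross (EuclideanSpace.single (2 : Fin 3) (1 : ℝ)) (Z m s)‖⁻¹ •
            ((1 / 2 : ℝ) • Z m s - α • cross (EuclideanSpace.single (2 : Fin 3) (1 : ℝ)) (Z m s))⟫ / g /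
            ‖(1 / 2 : ℝ) • Z m s - α • cross (EuclideanSpace.single (2 : Fin 3) (1 : ℝ)) (Z m s)‖ ^ 2) •
          cross (‖(1 / 2 : ℝ) • Z m s - α • cross (EuclideanSpace.single (2 : Fin 3) (1 : ℝ)) (Z m s)‖⁻¹ •
              ((1 / 2 : ℝ) • Z m s - α • cross (EuclideanSpace.single (2 : Fin 3) (1 : ℝ)) (Z m s)))
            ((1 / 2 : ℝ) • deriv (Z m) s - α • cross (EuclideanSpace.single (2 : Fin 3) (1 : ℝ)) (deriv (Z m) s))‖ *
        ‖Z m s‖ ≤ ε m)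
    (hε : Tendsto ε atTop (𝓝 0)) (hR₁ : Tendsto R₁ atTop (𝓝 0)) (hR₃ : Tendsto R₃ atTop atTop)
    (hYs : ContDiff ℝ 2 Ys) (hYsu : ∀ s, ‖deriv Ys s‖ = 1)
    (hYso : ∀ s, iteratedDeriv 2 Ys s = g • cross (deriv Ys s)
      ((1 / 2 : ℝ) • Ys s - α • cross (EuclideanSpace.single (2 : Fin 3) (1 : ℝ)) (Ys s)))
    (hYs0 : ‖Ys 0‖ ≤ 2)
    (hd0 : Tendsto (fun m => Z m 0) atTop (𝓝 (Ys 0)))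
    (hd1 : Tendsto (fun m => deriv (Z m) 0) atTop (𝓝 (deriv Ys 0)))
    {t : ℝ} (ht : 0 ≤ t) (hYt : Ys t ≠ 0) :
    (g * ⟪(1 / 2 : ℝ) • Ys t - α • cross (EuclideanSpace.single (2 : Fin 3) (1 : ℝ)) (Ys t),
        (1 / 2 : ℝ) • Ys t - α • cross (EuclideanSpace.single (2 : Fin 3) (1 : ℝ)) (Ys t)⟫) •
      (⟪(1 / 2 : ℝ) • Ys t - α • cross (EuclideanSpace.single (2 : Fin 3) (1 : ℝ)) (Ys t),
          (1 / 2 : ℝ) • Ys t - α • cross (EuclideanSpace.single (2 : Fin 3) (1 : ℝ)) (Ys t)⟫ • deriv Ys t -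
        ⟪deriv Ys t, (1 / 2 : ℝ) • Ys t - α • cross (EuclideanSpace.single (2 : Fin 3) (1 : ℝ)) (Ys t)⟫ •
          ((1 / 2 : ℝ) • Ys t - α • cross (EuclideanSpace.single (2 : Fin 3) (1 : ℝ)) (Ys t))) =
    ⟪deriv Ys t, (1 / 2 : ℝ) • Ys t - α • cross (EuclideanSpace.single (2 : Fin 3) (1 : ℝ)) (Ys t)⟫ •
      cross ((1 / 2 : ℝ) • Ys t - α • cross (EuclideanSpace.single (2 : Fin 3) (1 : ℝ)) (Ys t))
        ((1 / 2 : ℝ) • deriv Ys t - α • cross (EuclideanSpace.single (2 : Fin 3) (1 : ℝ)) (deriv Ys t)) := by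
  -- drift bound `‖A y‖ ≤ (½+|α|)‖y‖` (as `ZeroAccretionSelection.norm_drift_le`; kept local)
  have norm_drift_le_lin : ∀ y : EuclideanSpace ℝ (Fin 3),
      ‖(1 / 2 : ℝ) • y - α • cross (EuclideanSpace.single (2 : Fin 3) (1 : ℝ)) y‖ ≤ (1 / 2 + |α|) * ‖y‖ := by
    intro y
    have hcr : ‖cross (EuclideanSpace.single (2 : Fin 3) (1 : ℝ)) y‖ ≤ ‖y‖ := by
      have := norm_cross_le_norm_mul_norm (EuclideanSpace.single (2 : Fin 3) (1 : ℝ)) y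
      have he : ‖(EuclideanSpace.single (2 : Fin 3) (1 : ℝ))‖ = 1 := by simp
      rwa [he, one_mul] at this
    calc ‖(1 / 2 : ℝ) • y - α • cross (EuclideanSpace.single (2 : Fin 3) (1 : ℝ)) y‖
        ≤ ‖(1 / 2 : ℝ) • y‖ + ‖α • cross (EuclideanSpace.single (2 : Fin 3) (1 : ℝ)) y‖ := norm_sub_le _ _
      _ = 1 / 2 * ‖y‖ + |α| * ‖cross (EuclideanSpace.single (2 : Fin 3) (1 : ℝ)) y‖ := by
          rw [norm_smul, norm_smul, Real.norm_eq_abs, Real.norm_eq_abs,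
            abs_of_pos (by norm_num : (0:ℝ) < 1 / 2)]
      _ ≤ 1 / 2 * ‖y‖ + |α| * ‖y‖ := by gcongr
      _ = (1 / 2 + |α|) * ‖y‖ := by ring
  -- the locus map
  set Φ := (fun p : EuclideanSpace ℝ (Fin 3) × EuclideanSpace ℝ (Fin 3) =>
      (g * ⟪(1 / 2 : ℝ) • p.1 - α • cross (EuclideanSpace.single (2 : Fin 3) (1 : ℝ)) p.1,
          (1 / 2 : ℝ) • p.1 - α • cross (EuclideanSpace.single (2 : Fin 3) (1 : ℝ)) p.1⟫) •
        (⟪(1 / 2 : ℝ) • p.1 - α • cross (EuclideanSpace.single (2 : Fin 3) (1 : ℝ)) p.1,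
            (1 / 2 : ℝ) • p.1 - α • cross (EuclideanSpace.single (2 : Fin 3) (1 : ℝ)) p.1⟫ • p.2 -
          ⟪p.2, (1 / 2 : ℝ) • p.1 - α • cross (EuclideanSpace.single (2 : Fin 3) (1 : ℝ)) p.1⟫ •
            ((1 / 2 : ℝ) • p.1 - α • cross (EuclideanSpace.single (2 : Fin 3) (1 : ℝ)) p.1)) -
      ⟪p.2, (1 / 2 : ℝ) • p.1 - α • cross (EuclideanSpace.single (2 : Fin 3) (1 : ℝ)) p.1⟫ •
        cross ((1 / 2 : ℝ) • p.1 - α • cross (EuclideanSpace.single (2 : Fin 3) (1 : ℝ)) p.1)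
          ((1 / 2 : ℝ) • p.2 - α • cross (EuclideanSpace.single (2 : Fin 3) (1 : ℝ)) p.2)) with hΦ
  have hΦc : Continuous Φ := continuous_locus g α
  -- pointwise convergence at time `t`
  have hconv : Tendsto (fun m => (Z m t, deriv (Z m) t)) atTop (𝓝 (Ys t, deriv Ys t)) := by
    set K := Real.exp ((1 + |g| * (1 / 2 + |α|) * (2 + t + 2)) * t) with hK
    have hD : Tendsto (fun m => max ‖Z m 0 - Ys 0‖ ‖deriv (Z m) 0 - deriv Ys 0‖ * K) atTop (𝓝 0) := by
      have h1 : Tendsto (fun m => ‖Z m 0 - Ys 0‖) atTop (𝓝 0) := tendsto_iff_norm_sub_tendsto_zero.1 hd0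
      have h2 : Tendsto (fun m => ‖deriv (Z m) 0 - deriv Ys 0‖) atTop (𝓝 0) :=
        tendsto_iff_norm_sub_tendsto_zero.1 hd1
      have := (h1.max h2).mul_const K
      simpa using this
    have hb : ∀ m, ‖Z m t - Ys t‖ ≤ max ‖Z m 0 - Ys 0‖ ‖deriv (Z m) 0 - deriv Ys 0‖ * K ∧
        ‖deriv (Z m) t - deriv Ys t‖ ≤ max ‖Z m 0 - Ys 0‖ ‖deriv (Z m) 0 - deriv Ys 0‖ * K :=
      fun m => continuous_dependence_forward (by norm_num : (0:ℝ) ≤ 2) (hZ m) hYs (hZu m) hYsu (hZo m) hYso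
        (hZ0 m) hYs0 ht
    have c1 : Tendsto (fun m => Z m t) atTop (𝓝 (Ys t)) :=
      tendsto_iff_norm_sub_tendsto_zero.2
        (squeeze_zero (fun m => norm_nonneg _) (fun m => (hb m).1) hD)
    have c2 : Tendsto (fun m => deriv (Z m) t) atTop (𝓝 (deriv Ys t)) :=
      tendsto_iff_norm_sub_tendsto_zero.2
        (squeeze_zero (fun m => norm_nonneg _) (fun m => (hb m).2) hD)
    exact c1.prodMk_nhds c2
  have hΦlim : Tendsto (fun m => Φ (Z m t, deriv (Z m) t)) atTop (𝓝 (Φ (Ys t, deriv Ys t))) :=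
    (hΦc.tendsto _).comp hconv
  -- eventually the shell bound applies at `t`
  set r := ‖Ys t‖ with hr
  have hrpos : 0 < r := norm_pos_iff.2 hYt
  have hnorm : Tendsto (fun m => ‖Z m t‖) atTop (𝓝 r) := (continuous_norm.tendsto _).comp
    ((continuous_fst.tendsto _).comp hconv)
  have ev1 : ∀ᶠ m in atTop, r / 2 < ‖Z m t‖ := hnorm.eventually (lt_mem_nhds (by linarith))
  have ev2 : ∀ᶠ m in atTop, ‖Z m t‖ < 2 * r := hnorm.eventually (gt_mem_nhds (by linarith))
  have ev3 : ∀ᶠ m in atTop, R₁ m < r / 2 := hR₁.eventually (gt_mem_nhds (by linarith))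
  have ev4 : ∀ᶠ m in atTop, 2 * r < R₃ m := hR₃.eventually (eventually_gt_atTop _)
  -- the norm of `Φ` along the sequence tends to zero
  have hΦsmall : Tendsto (fun m => Φ (Z m t, deriv (Z m) t)) atTop (𝓝 0) := by
    rw [tendsto_zero_iff_norm_tendsto_zero]
    have hbound : ∀ᶠ m in atTop, ‖Φ (Z m t, deriv (Z m) t)‖ ≤
        |g| * ((1 / 2 + |α|) * (2 * r)) ^ 4 * (2 / r) * |ε m| := by
      filter_upwards [ev1, ev2, ev3, ev4] with m h1 h2 h3 h4
      have hZne : Z m t ≠ 0 := by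
        intro h0; rw [h0, norm_zero] at h1; linarith
      have hBne := drift_ne_zero α hZne
      have hsm := hsh m t (by linarith) (by linarith)
      have hkey := smul_defect_eq_locus (α := α) (T := deriv (Z m) t) hg hBne
      have hΦm : Φ (Z m t, deriv (Z m) t) = (g * ‖(1 / 2 : ℝ) • Z m t -
          α • cross (EuclideanSpace.single (2 : Fin 3) (1 : ℝ)) (Z m t)‖ ^ 4) • _ := hkey.symm
      rw [hΦm, norm_smul, Real.norm_eq_abs, abs_mul, abs_pow, abs_norm]
      have hB4 : ‖(1 / 2 : ℝ) • Z m t - α • cross (EuclideanSpace.single (2 : Fin 3) (1 : ℝ)) (Z m t)‖ ^ 4 ≤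
          ((1 / 2 + |α|) * (2 * r)) ^ 4 := by
        have := norm_drift_le_lin (Z m t)
        exact pow_le_pow_left₀ (norm_nonneg _) (this.trans (by gcongr)) 4
      have hdef : ‖deriv (Z m) t -
          ⟪deriv (Z m) t, ‖(1 / 2 : ℝ) • Z m t - α • cross (EuclideanSpace.single (2 : Fin 3) (1 : ℝ)) (Z m t)‖⁻¹ •
            ((1 / 2 : ℝ) • Z m t - α • cross (EuclideanSpace.single (2 : Fin 3) (1 : ℝ)) (Z m t))⟫ •
          (‖(1 / 2 : ℝ) • Z m t - α • cross (EuclideanSpace.single (2 : Fin 3) (1 : ℝ)) (Z m t)‖⁻¹ •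
            ((1 / 2 : ℝ) • Z m t - α • cross (EuclideanSpace.single (2 : Fin 3) (1 : ℝ)) (Z m t))) -
        (⟪deriv (Z m) t, ‖(1 / 2 : ℝ) • Z m t - α • cross (EuclideanSpace.single (2 : Fin 3) (1 : ℝ)) (Z m t)‖⁻¹ •
            ((1 / 2 : ℝ) • Z m t - α • cross (EuclideanSpace.single (2 : Fin 3) (1 : ℝ)) (Z m t))⟫ / g /
            ‖(1 / 2 : ℝ) • Z m t - α • cross (EuclideanSpace.single (2 : Fin 3) (1 : ℝ)) (Z m t)‖ ^ 2) •
          cross (‖(1 / 2 : ℝ) • Z m t - α • cross (EuclideanSpace.single (2 : Fin 3) (1 : ℝ)) (Z m t)‖⁻¹ •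
              ((1 / 2 : ℝ) • Z m t - α • cross (EuclideanSpace.single (2 : Fin 3) (1 : ℝ)) (Z m t)))
            ((1 / 2 : ℝ) • deriv (Z m) t - α • cross (EuclideanSpace.single (2 : Fin 3) (1 : ℝ)) (deriv (Z m) t))‖
          ≤ (2 / r) * |ε m| := by
        have hle : ε m ≤ |ε m| := le_abs_self _
        rw [div_mul_eq_mul_div, le_div_iff₀ hrpos]
        calc _ = _ * r := rfl
          _ ≤ _ * (2 * ‖Z m t‖) := by gcongr; linarith
          _ = 2 * (_ * ‖Z m t‖) := by ring
          _ ≤ 2 * ε m := by gcongr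
          _ ≤ 2 * |ε m| := by gcongr
      calc |g| * ‖(1 / 2 : ℝ) • Z m t - α • cross (EuclideanSpace.single (2 : Fin 3) (1 : ℝ)) (Z m t)‖ ^ 4 * _
          ≤ |g| * ((1 / 2 + |α|) * (2 * r)) ^ 4 * ((2 / r) * |ε m|) := by gcongr
        _ = |g| * ((1 / 2 + |α|) * (2 * r)) ^ 4 * (2 / r) * |ε m| := by ring
    have hlim0 : Tendsto (fun m => |g| * ((1 / 2 + |α|) * (2 * r)) ^ 4 * (2 / r) * |ε m|) atTop (𝓝 0) := by
      have := (continuous_abs.tendsto _).comp hε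
      simp only [Function.comp_def, abs_zero] at this
      simpa using this.const_mul (|g| * ((1 / 2 + |α|) * (2 * r)) ^ 4 * (2 / r))
    exact squeeze_zero' (Eventually.of_forall fun m => norm_nonneg _) hbound hlim0
  have heq : Φ (Ys t, deriv Ys t) = 0 := tendsto_nhds_unique hΦlim hΦsmall
  have := sub_eq_zero.1 heq
  exact this

end Summit.NavierStokesRegularity.NavierStokesRegularity.Theorems.SkeletonEquilibrium.MirrorPoint
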